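import Summits.Ventures.Crystal3D.Theorems.StickyWulffConstantPolycrystalWulffBoundTwinSectionShiftSlabHolds

/-!
# The CAP REFLECTION of the crux's Wulff body along a horizontal `⟨112⟩` direction, in the crux's own
# vocabulary (offset bound `2/√6` of the twin's fibres; for the general single-axis rung of
# `PolycrystalWulffBound`, line `PolyDensity`, crux `stmt-Ventures-19482`)

Route `StickyWulffConstant` of the venture `Summits/Ventures/Crystal3D`, second prover lane (poly-p2,
gen 10).  For a frame `A` satisfying the self-clause of the crux's co-axiality `Ax m`, a horizontal
nearest-neighbour bond `u ∈ A '' Λ₀` (`‖u‖ = 1`, `u ⊥ m`) and a unit `w ⊥ m, u` (a horizontal `⟨112⟩`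
direction of `A`'s lattice), the Wulff body `W(A)` has the cap-reflection property along `w`:
`y ∈ W(A)`, `⟪y, w⟫ ≥ 1/√6 ⇒ y − 2(⟪y, w⟫ − 1/√6)·w ∈ W(A)` (`cruxWulffBody_cap_reflect`), and the
mirrored statement for `⟪y, w⟫ ≤ −1/√6` (`cruxWulffBody_cap_reflect_neg`).  Consequently every chord of
`W(A)` parallel to `w`, `{y₀ + s w}` with `s ∈ [lo, hi]`, has `|lo + hi| ≤ 2/√6`
(`cruxWulffBody_chord_offset_le`): the twin body `R_m W(A) = R_w W(A)` is obtained from `W(A)` by sliding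
every `w`-chord along itself by at most `2/√6` — the fibre-translate input of the multi-body chimera
engine (`…MultiBodyChimera`).  Transport of gen 9's cubic-frame cap reflection
(`cap_reflect_mem_fccWulffBody₀/₁/₂`, tight: `D = 2/√6` exactly) along the frame of
`exists_frame_cruxWulffBody_lattice`; the zone of `w` is read off the bond `u` (`exists_zone_eq_smul`).
WHAT THIS IS NOT: the rung; nothing about perimeters; the crux is not claimed.
-/

noncomputable section

open scoped BigOperators InnerProductSpace ENNReal
open MeasureTheory Set

namespace Summit.Ventures.Crystal3D.Theorems

open Summit.Ventures.Crystal3D.Cruxes.TextureLiminf.TexShadow (E3)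
open Literature.MathematicalPhysics.StatisticalMechanics (fccStacking barlowStacking IsHaggSeq
  fccWulffBody isCompact_fccWulffBody)
open Literature.Geometry.DiscreteGeometry (fccKissingPattern fccInt scaledPattern intVec intVec_apply)

/-- **The zone of a horizontal unit vector orthogonal to a horizontal bond, as a multiple.**  In the
cubic frame: `u'` a nearest-neighbour bond with `u' ⊥ (1,1,1)`, `w'` a unit vector `⊥ (1,1,1)` and
`⊥ u'` ⇒ `w' = c • d_k` for one of the three horizontal `⟨112⟩` vectors `d_k` and `6 c² = 1`. -/
theorem exists_zone_eq_smul {u' w' : E3} (hu' : u' ∈ (fccKissingPattern : Set E3))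
    (hu'd : ⟪u', (!₂[(1 : ℝ), 1, 1] : E3)⟫_ℝ = 0) (hw' : ‖w'‖ = 1)
    (hw'd : ⟪w', (!₂[(1 : ℝ), 1, 1] : E3)⟫_ℝ = 0) (hw'u : ⟪w', u'⟫_ℝ = 0) :
    ∃ dk : E3, (dk = !₂[(-2 : ℝ), 1, 1] ∨ dk = !₂[(1 : ℝ), -2, 1] ∨ dk = !₂[(1 : ℝ), 1, -2]) ∧
      ∃ c : ℝ, 6 * c ^ 2 = 1 ∧ w' = c • dk := by
  rw [Finset.mem_coe, fccKissingPattern, scaledPattern, Finset.mem_image] at hu'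
  obtain ⟨t, ht, rfl⟩ := hu'
  have h2 : (Real.sqrt ((2 : ℕ) : ℝ))⁻¹ ≠ 0 := by positivity
  have hsum : (t 0 : ℝ) + t 1 + t 2 = 0 := by
    rw [real_inner_smul_left, mul_eq_zero] at hu'd
    rcases hu'd with h | h
    · exact absurd h h2
    · rw [real_inner_comm, (inner_cubic_vectors _).1] at h
      simpa [intVec_apply] using h
  have hwt : (t 0 : ℝ) * w' 0 + t 1 * w' 1 + t 2 * w' 2 = 0 := by
    rw [real_inner_smul_right, mul_eq_zero] at hw'u
    rcases hw'u with h | h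
    · exact absurd h h2
    · have : ⟪w', intVec t⟫_ℝ = w' 0 * t 0 + w' 1 * t 1 + w' 2 * t 2 := by
        simp [PiLp.inner_apply, Fin.sum_univ_three, intVec_apply, mul_comm]
      rw [this] at h
      linarith [h]
  have hwd : w' 0 + w' 1 + w' 2 = 0 := by
    rw [real_inner_comm, (inner_cubic_vectors _).1] at hw'd; exact hw'd
  have hwn : w' 0 ^ 2 + w' 1 ^ 2 + w' 2 ^ 2 = 1 := by
    have h := hw'
    rw [EuclideanSpace.norm_eq, Real.sqrt_eq_one, Fin.sum_univ_three] at h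
    simpa only [Real.norm_eq_abs, sq_abs] using h
  -- `w'` as a vector of coordinates
  have hwvec : ∀ (dk : E3) (c : ℝ), w' 0 = c * dk 0 → w' 1 = c * dk 1 → w' 2 = c * dk 2 →
      w' = c • dk := by
    intro dk c h0 h1 h2'
    ext i
    fin_cases i <;> simp [h0, h1, h2']
  simp only [fccInt, Finset.mem_insert, Finset.mem_singleton] at ht
  rcases ht with rfl | rfl | rfl | rfl | rfl | rfl | rfl | rfl | rfl | rfl | rfl | rfl <;>
    simp only [Matrix.cons_val_zero, Matrix.cons_val_one, Matrix.head_cons, Matrix.cons_val_two,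
      Matrix.tail_cons, Int.cast_one, Int.cast_neg, Int.cast_zero] at hsum hwt
  · norm_num at hsum
  · -- t = (1,-1,0): zone 2
    have h01 : w' 1 = w' 0 := by linarith
    have h2' : w' 2 = -2 * w' 0 := by linarith
    refine ⟨_, Or.inr (Or.inr rfl), w' 0, ?_, hwvec _ _ ?_ ?_ ?_⟩
    · rw [h01, h2'] at hwn; linear_combination hwn
    all_goals simp [h01, h2', mul_comm]
  · -- t = (-1,1,0): zone 2
    have h01 : w' 1 = w' 0 := by linarith
    have h2' : w' 2 = -2 * w' 0 := by linarith
    refine ⟨_, Or.inr (Or.inr rfl), w' 0, ?_, hwvec _ _ ?_ ?_ ?_⟩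
    · rw [h01, h2'] at hwn; linear_combination hwn
    all_goals simp [h01, h2', mul_comm]
  · norm_num at hsum
  · norm_num at hsum
  · -- t = (1,0,-1): zone 1
    have h02 : w' 2 = w' 0 := by linarith
    have h1' : w' 1 = -2 * w' 0 := by linarith
    refine ⟨_, Or.inr (Or.inl rfl), w' 0, ?_, hwvec _ _ ?_ ?_ ?_⟩
    · rw [h02, h1'] at hwn; linear_combination hwn
    all_goals simp [h02, h1', mul_comm]
  · -- t = (-1,0,1): zone 1
    have h02 : w' 2 = w' 0 := by linarith
    have h1' : w' 1 = -2 * w' 0 := by linarith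
    refine ⟨_, Or.inr (Or.inl rfl), w' 0, ?_, hwvec _ _ ?_ ?_ ?_⟩
    · rw [h02, h1'] at hwn; linear_combination hwn
    all_goals simp [h02, h1', mul_comm]
  · norm_num at hsum
  · norm_num at hsum
  · -- t = (0,1,-1): zone 0
    have h12 : w' 2 = w' 1 := by linarith
    have h0' : w' 0 = -2 * w' 1 := by linarith
    refine ⟨_, Or.inl rfl, w' 1, ?_, hwvec _ _ ?_ ?_ ?_⟩
    · rw [h12, h0'] at hwn; linear_combination hwn
    all_goals simp [h12, h0', mul_comm]
  · -- t = (0,-1,1): zone 0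
    have h12 : w' 2 = w' 1 := by linarith
    have h0' : w' 0 = -2 * w' 1 := by linarith
    refine ⟨_, Or.inl rfl, w' 1, ?_, hwvec _ _ ?_ ?_ ?_⟩
    · rw [h12, h0'] at hwn; linear_combination hwn
    all_goals simp [h12, h0', mul_comm]
  · norm_num at hsum

/-- Cap reflection of the reference body along any of the three horizontal `⟨112⟩` vectors. -/
theorem cap_reflect_mem_fccWulffBody_of_zone {dk : E3}
    (hdk : dk = !₂[(-2 : ℝ), 1, 1] ∨ dk = !₂[(1 : ℝ), -2, 1] ∨ dk = !₂[(1 : ℝ), 1, -2]) :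
    ∀ x ∈ fccWulffBody, 1 ≤ ⟪x, dk⟫_ℝ → x - (2 * (⟪x, dk⟫_ℝ - 1) / 6) • dk ∈ fccWulffBody := by
  rcases hdk with rfl | rfl | rfl
  · exact fun x hx h1 => cap_reflect_mem_fccWulffBody₀ hx h1
  · exact fun x hx h1 => cap_reflect_mem_fccWulffBody₁ hx h1
  · exact fun x hx h1 => cap_reflect_mem_fccWulffBody₂ hx h1

/-- **Cap reflection in the cubic frame along a unit `⟨112⟩` direction `w' = c • d_k`**
(`6c² = 1`): `x ∈ W₁`, `1/√6 ≤ ⟪x, w'⟫ ⇒ x − 2(⟪x, w'⟫ − 1/√6)·w' ∈ W₁`. -/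
theorem cap_reflect_mem_fccWulffBody_unit {dk : E3}
    (hdk : dk = !₂[(-2 : ℝ), 1, 1] ∨ dk = !₂[(1 : ℝ), -2, 1] ∨ dk = !₂[(1 : ℝ), 1, -2])
    {c : ℝ} (hc : 6 * c ^ 2 = 1) {x : E3} (hx : x ∈ fccWulffBody)
    (h1 : 1 / Real.sqrt 6 ≤ ⟪x, c • dk⟫_ℝ) :
    x - (2 * (⟪x, c • dk⟫_ℝ - 1 / Real.sqrt 6)) • (c • dk) ∈ fccWulffBody := by
  have hcap := cap_reflect_mem_fccWulffBody_of_zone hdk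
  have h6 : (0 : ℝ) < Real.sqrt 6 := Real.sqrt_pos.2 (by norm_num)
  have h6sq : Real.sqrt 6 ^ 2 = 6 := Real.sq_sqrt (by norm_num)
  have hcs : c = 1 / Real.sqrt 6 ∨ c = -(1 / Real.sqrt 6) := by
    have : c ^ 2 = (1 / Real.sqrt 6) ^ 2 := by
      rw [div_pow, one_pow, h6sq]; linarith
    exact sq_eq_sq_iff_eq_or_eq_neg.1 this
  rw [real_inner_smul_right] at h1 ⊢
  rcases hcs with rfl | rfl
  · -- `c = 1/√6`: the cap `⟪x, d_k⟫ ≥ 1`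
    have hx1 : 1 ≤ ⟪x, dk⟫_ℝ := by
      have h := mul_le_mul_of_nonneg_left h1 h6.le
      rw [← mul_assoc, mul_one_div_cancel h6.ne', one_mul] at h
      simpa using h
    have h := hcap x hx hx1
    have e : (2 * (1 / Real.sqrt 6 * ⟪x, dk⟫_ℝ - 1 / Real.sqrt 6)) • ((1 / Real.sqrt 6) • dk) =
        (2 * (⟪x, dk⟫_ℝ - 1) / 6) • dk := by
      rw [smul_smul]
      congr 1
      field_simp
      rw [h6sq]
      ring
    rw [e]
    exact h
  · -- `c = -1/√6`: the cap `⟪x, d_k⟫ ≤ -1`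
    have hx1 : ⟪x, dk⟫_ℝ ≤ -1 := by
      have h := mul_le_mul_of_nonneg_left h1 h6.le
      rw [mul_one_div_cancel h6.ne'] at h
      have e : Real.sqrt 6 * (-(1 / Real.sqrt 6) * ⟪x, dk⟫_ℝ) = -⟪x, dk⟫_ℝ := by
        field_simp
      rw [e] at h
      linarith
    have h := cap_reflect_mem_fccWulffBody_neg hcap hx hx1
    have e : (2 * (-(1 / Real.sqrt 6) * ⟪x, dk⟫_ℝ - 1 / Real.sqrt 6)) • (-(1 / Real.sqrt 6) • dk) =
        (2 * (⟪x, dk⟫_ℝ + 1) / 6) • dk := by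
      rw [smul_smul]
      congr 1
      field_simp
      rw [h6sq]
      ring
    rw [e]
    exact h

/-- **Cap reflection of the crux's Wulff body along a horizontal `⟨112⟩` direction.**  For a frame
`A` with the self-clause of `Ax m`, a horizontal nearest-neighbour bond `u ∈ A '' Λ₀` (`‖u‖ = 1`,
`u ⊥ m`) and a unit `w ⊥ m, u`: `y ∈ W(A)`, `1/√6 ≤ ⟪y, w⟫ ⇒ y − 2(⟪y, w⟫ − 1/√6)·w ∈ W(A)`. -/
theorem cruxWulffBody_cap_reflect {m : E3} {A : E3 ≃ₗᵢ[ℝ] E3}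
    (hAx : ∃ (L : E3 ≃ₗᵢ[ℝ] E3) (s₁ s₂ : E3) (σ σ' : ℤ → ℤ), IsHaggSeq σ ∧ IsHaggSeq σ' ∧
      L (EuclideanSpace.single (2 : Fin 3) (1 : ℝ)) = m ∧
      A '' fccStacking 1 (Real.sqrt (2 / 3)) ⊆
        (fun q => L q + s₁) '' barlowStacking 1 (Real.sqrt (2 / 3)) σ ∧
      A '' fccStacking 1 (Real.sqrt (2 / 3)) ⊆
        (fun q => L q + s₂) '' barlowStacking 1 (Real.sqrt (2 / 3)) σ')
    {u w : E3} (hu : u ∈ A '' fccStacking 1 (Real.sqrt (2 / 3))) (hu1 : ‖u‖ = 1) (hum : ⟪u, m⟫_ℝ = 0)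
    (hw : ‖w‖ = 1) (hwm : ⟪w, m⟫_ℝ = 0) (hwu : ⟪w, u⟫_ℝ = 0)
    {y : E3} (hy : y ∈ {y : E3 | ∀ ν : E3, ⟪y, ν⟫_ℝ ≤ Real.sqrt 2 / 4 *
        ∑ᶠ w ∈ {w | w ∈ fccStacking 1 (Real.sqrt (2 / 3)) ∧ ‖w‖ = 1}, |⟪w, A.symm ν⟫_ℝ|})
    (h1 : 1 / Real.sqrt 6 ≤ ⟪y, w⟫_ℝ) :
    y - (2 * (⟪y, w⟫_ℝ - 1 / Real.sqrt 6)) • w ∈ {y : E3 | ∀ ν : E3, ⟪y, ν⟫_ℝ ≤ Real.sqrt 2 / 4 *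
        ∑ᶠ w ∈ {w | w ∈ fccStacking 1 (Real.sqrt (2 / 3)) ∧ ‖w‖ = 1}, |⟪w, A.symm ν⟫_ℝ|} := by
  -- frames (as in `cruxWulffBody_twin_slab_cdf_le`)
  obtain ⟨L', s₁, -, σ, -, hσ, -, hL'm, hA1, -⟩ := hAx
  have hm : ‖m‖ = 1 := by rw [← hL'm, LinearIsometryEquiv.norm_map, PiLp.norm_single, norm_one]
  obtain ⟨M, hWA, hAΛ, hMm⟩ := exists_frame_cruxWulffBody_lattice (m := m) (A := A)
    ⟨L', s₁, s₁, σ, σ, hσ, hσ, hL'm, hA1, hA1⟩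
  obtain ⟨L, hL, c, hLc⟩ := exists_cubicFrame_unitShell_eq
  have hW1 := cruxWulffBody_eq_image_fccWulffBody hL (LinearIsometryEquiv.refl ℝ E3)
  rw [LinearIsometryEquiv.trans_refl] at hW1
  rw [hW1, ← image_comp] at hWA
  set T : E3 ≃ₗᵢ[ℝ] E3 := L.trans M with hT
  have hWA' : {y : E3 | ∀ ν : E3, ⟪y, ν⟫_ℝ ≤ Real.sqrt 2 / 4 *
      ∑ᶠ w ∈ {w | w ∈ fccStacking 1 (Real.sqrt (2 / 3)) ∧ ‖w‖ = 1}, |⟪w, A.symm ν⟫_ℝ|} =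
      T '' fccWulffBody := by
    rw [hWA, hT, LinearIsometryEquiv.coe_trans]
  set d : E3 := !₂[(1 : ℝ), 1, 1] with hd
  obtain ⟨ε, hε, hTd⟩ : ∃ ε : ℝ, (ε = 1 ∨ ε = -1) ∧ T d = (ε * c) • m := by
    rcases hMm with h | h
    · exact ⟨1, Or.inl rfl, by rw [hT, LinearIsometryEquiv.coe_trans, Function.comp_apply, hLc,
        LinearIsometryEquiv.map_smul, h, one_mul]⟩
    · exact ⟨-1, Or.inr rfl, by rw [hT, LinearIsometryEquiv.coe_trans, Function.comp_apply, hLc,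
        LinearIsometryEquiv.map_smul, h, smul_neg, ← neg_smul, neg_one_mul]⟩
  -- the zone of `u` in the cubic frame
  have hu' : T.symm u ∈ (fccKissingPattern : Set E3) := by
    rw [hAΛ] at hu
    obtain ⟨p, hp, rfl⟩ := hu
    have hp1 : ‖p‖ = 1 := by rw [← hu1, LinearIsometryEquiv.norm_map]
    have hpshell : p ∈ {w : E3 | w ∈ fccStacking 1 (Real.sqrt (2 / 3)) ∧ ‖w‖ = 1} := ⟨hp, hp1⟩
    rw [hL] at hpshell
    obtain ⟨q, hq, rfl⟩ := hpshell
    have : T.symm (M (L q)) = q := by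
      rw [hT]
      show (L.trans M).symm ((L.trans M) q) = q
      exact (L.trans M).symm_apply_apply q
    rw [this]
    exact hq
  have hinner : ∀ x z : E3, ⟪T.symm x, T.symm z⟫_ℝ = ⟪x, z⟫_ℝ := fun x z =>
    LinearIsometryEquiv.inner_map_map T.symm x z
  have hsd : ∀ x : E3, ⟪T.symm x, d⟫_ℝ = (ε * c) * ⟪x, m⟫_ℝ := by
    intro x
    rw [← T.inner_map_map (T.symm x) d, T.apply_symm_apply, hTd, real_inner_smul_right]
  have hu'd : ⟪T.symm u, d⟫_ℝ = 0 := by rw [hsd, hum, mul_zero]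
  have hw' : ‖T.symm w‖ = 1 := by rw [LinearIsometryEquiv.norm_map, hw]
  have hw'd : ⟪T.symm w, d⟫_ℝ = 0 := by rw [hsd, hwm, mul_zero]
  have hw'u : ⟪T.symm w, T.symm u⟫_ℝ = 0 := by rw [hinner, hwu]
  obtain ⟨dk, hdk, c', hc', hwc⟩ := exists_zone_eq_smul hu' hu'd hw' hw'd hw'u
  -- the point in the cubic frame
  rw [hWA'] at hy ⊢
  obtain ⟨x, hx, rfl⟩ := hy
  have hyw : ⟪T x, w⟫_ℝ = ⟪x, c' • dk⟫_ℝ := by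
    rw [← hwc, ← hinner (T x) w, LinearIsometryEquiv.symm_apply_apply]
  have hx' := cap_reflect_mem_fccWulffBody_unit hdk hc' hx (by rw [← hyw]; exact h1)
  refine ⟨_, hx', ?_⟩
  rw [map_sub, LinearIsometryEquiv.map_smul, ← hyw]
  congr 2
  rw [← hwc, LinearIsometryEquiv.apply_symm_apply]

/-- The crux's Wulff body is centrally symmetric (pointwise form). -/
theorem neg_mem_cruxWulffBody' (A : E3 ≃ₗᵢ[ℝ] E3) {y : E3}
    (hy : y ∈ {y : E3 | ∀ ν : E3, ⟪y, ν⟫_ℝ ≤ Real.sqrt 2 / 4 *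
        ∑ᶠ w ∈ {w | w ∈ fccStacking 1 (Real.sqrt (2 / 3)) ∧ ‖w‖ = 1}, |⟪w, A.symm ν⟫_ℝ|}) :
    -y ∈ {y : E3 | ∀ ν : E3, ⟪y, ν⟫_ℝ ≤ Real.sqrt 2 / 4 *
        ∑ᶠ w ∈ {w | w ∈ fccStacking 1 (Real.sqrt (2 / 3)) ∧ ‖w‖ = 1}, |⟪w, A.symm ν⟫_ℝ|} := by
  rw [← neg_cruxWulffBody_eq A]
  exact Set.neg_mem_neg.2 hy

/-- **Mirrored cap reflection**: `y ∈ W(A)`, `⟪y, w⟫ ≤ −1/√6 ⇒ y − 2(⟪y, w⟫ + 1/√6)·w ∈ W(A)`. -/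
theorem cruxWulffBody_cap_reflect_neg {m : E3} {A : E3 ≃ₗᵢ[ℝ] E3}
    (hAx : ∃ (L : E3 ≃ₗᵢ[ℝ] E3) (s₁ s₂ : E3) (σ σ' : ℤ → ℤ), IsHaggSeq σ ∧ IsHaggSeq σ' ∧
      L (EuclideanSpace.single (2 : Fin 3) (1 : ℝ)) = m ∧
      A '' fccStacking 1 (Real.sqrt (2 / 3)) ⊆
        (fun q => L q + s₁) '' barlowStacking 1 (Real.sqrt (2 / 3)) σ ∧
      A '' fccStacking 1 (Real.sqrt (2 / 3)) ⊆
        (fun q => L q + s₂) '' barlowStacking 1 (Real.sqrt (2 / 3)) σ')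
    {u w : E3} (hu : u ∈ A '' fccStacking 1 (Real.sqrt (2 / 3))) (hu1 : ‖u‖ = 1) (hum : ⟪u, m⟫_ℝ = 0)
    (hw : ‖w‖ = 1) (hwm : ⟪w, m⟫_ℝ = 0) (hwu : ⟪w, u⟫_ℝ = 0)
    {y : E3} (hy : y ∈ {y : E3 | ∀ ν : E3, ⟪y, ν⟫_ℝ ≤ Real.sqrt 2 / 4 *
        ∑ᶠ w ∈ {w | w ∈ fccStacking 1 (Real.sqrt (2 / 3)) ∧ ‖w‖ = 1}, |⟪w, A.symm ν⟫_ℝ|})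
    (h1 : ⟪y, w⟫_ℝ ≤ -(1 / Real.sqrt 6)) :
    y - (2 * (⟪y, w⟫_ℝ + 1 / Real.sqrt 6)) • w ∈ {y : E3 | ∀ ν : E3, ⟪y, ν⟫_ℝ ≤ Real.sqrt 2 / 4 *
        ∑ᶠ w ∈ {w | w ∈ fccStacking 1 (Real.sqrt (2 / 3)) ∧ ‖w‖ = 1}, |⟪w, A.symm ν⟫_ℝ|} := by
  have hny := neg_mem_cruxWulffBody' A hy
  have h := cruxWulffBody_cap_reflect hAx hu hu1 hum hw hwm hwu hny
    (by rw [inner_neg_left]; linarith)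
  have h' := neg_mem_cruxWulffBody' A h
  have e : -(-y - (2 * (⟪-y, w⟫_ℝ - 1 / Real.sqrt 6)) • w) = y - (2 * (⟪y, w⟫_ℝ + 1 / Real.sqrt 6)) • w := by
    rw [inner_neg_left]
    have hc : 2 * (-⟪y, w⟫_ℝ - 1 / Real.sqrt 6) = -(2 * (⟪y, w⟫_ℝ + 1 / Real.sqrt 6)) := by ring
    rw [hc, neg_smul]
    abel
  rw [e] at h'
  exact h'

/-- **Chord offsets are at most `2/√6`.**  If `lo` and `hi` are the extreme `w`-coordinates of the
chord of `W(A)` on the line `y₀ + ℝ w` (`⟪y₀, w⟫ = 0`; `y₀ + lo • w, y₀ + hi • w ∈ W(A)` and every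
`y₀ + s • w ∈ W(A)` has `lo ≤ s ≤ hi`), then `|lo + hi| ≤ 2/√6`: the chord's midpoint lies within
`1/√6` of the plane `w^⊥`, so the reflected chord `[-hi, -lo]` (the twin's fibre) is the translate of
`[lo, hi]` by at most `2/√6`. -/
theorem cruxWulffBody_chord_offset_le {m : E3} {A : E3 ≃ₗᵢ[ℝ] E3}
    (hAx : ∃ (L : E3 ≃ₗᵢ[ℝ] E3) (s₁ s₂ : E3) (σ σ' : ℤ → ℤ), IsHaggSeq σ ∧ IsHaggSeq σ' ∧
      L (EuclideanSpace.single (2 : Fin 3) (1 : ℝ)) = m ∧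
      A '' fccStacking 1 (Real.sqrt (2 / 3)) ⊆
        (fun q => L q + s₁) '' barlowStacking 1 (Real.sqrt (2 / 3)) σ ∧
      A '' fccStacking 1 (Real.sqrt (2 / 3)) ⊆
        (fun q => L q + s₂) '' barlowStacking 1 (Real.sqrt (2 / 3)) σ')
    {u w : E3} (hu : u ∈ A '' fccStacking 1 (Real.sqrt (2 / 3))) (hu1 : ‖u‖ = 1) (hum : ⟪u, m⟫_ℝ = 0)
    (hw : ‖w‖ = 1) (hwm : ⟪w, m⟫_ℝ = 0) (hwu : ⟪w, u⟫_ℝ = 0)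
    {y₀ : E3} (hy₀ : ⟪y₀, w⟫_ℝ = 0) {lo hi : ℝ}
    (hlo : y₀ + lo • w ∈ {y : E3 | ∀ ν : E3, ⟪y, ν⟫_ℝ ≤ Real.sqrt 2 / 4 *
        ∑ᶠ w ∈ {w | w ∈ fccStacking 1 (Real.sqrt (2 / 3)) ∧ ‖w‖ = 1}, |⟪w, A.symm ν⟫_ℝ|})
    (hhi : y₀ + hi • w ∈ {y : E3 | ∀ ν : E3, ⟪y, ν⟫_ℝ ≤ Real.sqrt 2 / 4 *
        ∑ᶠ w ∈ {w | w ∈ fccStacking 1 (Real.sqrt (2 / 3)) ∧ ‖w‖ = 1}, |⟪w, A.symm ν⟫_ℝ|})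
    (hmin : ∀ s : ℝ, y₀ + s • w ∈ {y : E3 | ∀ ν : E3, ⟪y, ν⟫_ℝ ≤ Real.sqrt 2 / 4 *
        ∑ᶠ w ∈ {w | w ∈ fccStacking 1 (Real.sqrt (2 / 3)) ∧ ‖w‖ = 1}, |⟪w, A.symm ν⟫_ℝ|} → lo ≤ s)
    (hmax : ∀ s : ℝ, y₀ + s • w ∈ {y : E3 | ∀ ν : E3, ⟪y, ν⟫_ℝ ≤ Real.sqrt 2 / 4 *
        ∑ᶠ w ∈ {w | w ∈ fccStacking 1 (Real.sqrt (2 / 3)) ∧ ‖w‖ = 1}, |⟪w, A.symm ν⟫_ℝ|} → s ≤ hi) :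
    |lo + hi| ≤ 2 / Real.sqrt 6 := by
  have hww : ⟪w, w⟫_ℝ = 1 := by rw [real_inner_self_eq_norm_sq, hw, one_pow]
  have hcoord : ∀ s : ℝ, ⟪y₀ + s • w, w⟫_ℝ = s := by
    intro s; rw [inner_add_left, real_inner_smul_left, hy₀, hww, zero_add, mul_one]
  have hpt : ∀ s a : ℝ, y₀ + s • w - a • w = y₀ + (s - a) • w := by
    intro s a; rw [sub_smul]; abel
  rw [abs_le]
  constructor
  · -- lower bound: if `lo < -1/√6`… reflect the lower cap point
    by_contra hcon
    push Not at hcon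
    have hlo' : ⟪y₀ + lo • w, w⟫_ℝ ≤ -(1 / Real.sqrt 6) := by
      rw [hcoord]
      by_contra h'
      push Not at h'
      -- then `lo > -1/√6`, and `hi ≥ lo` gives `lo + hi > -2/√6`
      have hlh : lo ≤ hi := hmin hi hhi
      have : -(2 / Real.sqrt 6) ≤ lo + hi := by
        have e : -(2 / Real.sqrt 6) = -(1 / Real.sqrt 6) + -(1 / Real.sqrt 6) := by ring
        rw [e]; linarith
      linarith
    have h := cruxWulffBody_cap_reflect_neg hAx hu hu1 hum hw hwm hwu hlo hlo'
    rw [hcoord, hpt] at h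
    have := hmax _ h
    have e : lo - 2 * (lo + 1 / Real.sqrt 6) = -lo - 2 / Real.sqrt 6 := by ring
    rw [e] at this
    linarith
  · by_contra hcon
    push Not at hcon
    have hhi' : 1 / Real.sqrt 6 ≤ ⟪y₀ + hi • w, w⟫_ℝ := by
      rw [hcoord]
      by_contra h'
      push Not at h'
      have hlh : lo ≤ hi := hmin hi hhi
      have : lo + hi ≤ 2 / Real.sqrt 6 := by
        have e : 2 / Real.sqrt 6 = 1 / Real.sqrt 6 + 1 / Real.sqrt 6 := by ring
        rw [e]; linarith
      linarith
    have h := cruxWulffBody_cap_reflect hAx hu hu1 hum hw hwm hwu hhi hhi'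
    rw [hcoord, hpt] at h
    have := hmin _ h
    have e : hi - 2 * (hi - 1 / Real.sqrt 6) = -hi + 2 / Real.sqrt 6 := by ring
    rw [e] at this
    linarith

end Summit.Ventures.Crystal3D.Theorems

end
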